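import Mathlib.MeasureTheory.Measure.Tilted
import Mathlib.Analysis.Convex.Integral
import Literature.MathematicalPhysics.QuantumFieldTheory.BalabanBlockSpecification
import HarnessLib

/-!
# Route `SourcedPressureJensen`, crux `SourcedPressureDecoupling` (stmt-QuantumFields-23808): the two-sided GIBBS
# (Peierls–Bogoliubov) bounds on a free-energy difference

The item's plan ("Gibbs two-sided variational bounds `−E₀[W] ≤ log(Z₁/Z₀) ≤ −E₁[W]` against a cell-decoupled reference;
only the UPPER bound on the torus increment is needed, so the true sourced torus state carries the seam term") rests on the
elementary convexity sandwich for two Boltzmann weights `e^{−V₀}`, `e^{−V₁}` on one probability space: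

  `−E_{μ₀}[V₁ − V₀] ≤ log Z₁ − log Z₀ ≤ −E_{μ₁}[V₁ − V₀]`,  `Z_i = E_μ e^{−V_i}`, `μ_i = e^{−V_i}μ/Z_i`

(Jensen under `μ₀`, resp. under `μ₁` with the roles exchanged).  This file proves it

* abstractly, for any probability measure and Mathlib's exponential tilt `Measure.tilted`
  (`integral_sub_le_log_integral_exp_sub_log_integral_exp`: `∫ (g − f) d(μ.tilted f) ≤ log ∫e^g dμ − log ∫e^f dμ`; the
  sandwich `gibbs_two_sided`; the one-weight forms `integral_le_log_integral_exp'` / `log_integral_exp_le_integral_tilted`),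
* and for the torus Wilson state `wilsonExpectation r.ρ β` of a lattice representation with CONTINUOUS potentials, in ratio
  form (no new definition of a perturbed state is introduced): `wilson_gibbs_two_sided`,
  `log_wilsonExpectation_exp_neg_le` (`log E e^{−W} ≤ −E[W e^{−W}]/E[e^{−W}]`, the upper companion of the Jensen floor
  `wilsonExpectation_le_log_wilsonExpectation_exp` of the `JensenFloor` toolkit).

Everything is proved; no definition, no named fact.  RECORD-label rung support (route target `XiPow` = an upper bound on the
lattice gap); the Yang–Mills mass gap is NOT proved by anything here. [folklore]
-/

set_option autoImplicit false

noncomputable section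

open MeasureTheory Real
open Literature.MathematicalPhysics.QuantumFieldTheory Literature.MathematicalPhysics.QuantumLattice

namespace Summit.QuantumFields.YangMills.Theorems.SourcedPressureJensen

/-! ### Abstract probability space -/

section Abstract

variable {α : Type*} [MeasurableSpace α] {μ : Measure α} [IsProbabilityMeasure μ]

omit [IsProbabilityMeasure μ] in
/-- The tilted mean as a ratio: `∫ G d(μ.tilted f) = (∫ e^{f} G dμ)/(∫ e^{f} dμ)`. [folklore] -/
theorem integral_tilted_eq_div (f G : α → ℝ) :
    ∫ x, G x ∂μ.tilted f = (∫ x, Real.exp (f x) * G x ∂μ) / ∫ x, Real.exp (f x) ∂μ := by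
  rw [integral_tilted]
  simp_rw [smul_eq_mul, div_mul_eq_mul_div]
  rw [integral_div]

/-- **Gibbs' inequality (one direction, two weights).**  For a probability measure `μ` and real `f, g` with `e^f`, `e^g`
and `e^f (g − f)` integrable: `∫ (g − f) d(μ.tilted f) ≤ log ∫ e^g dμ − log ∫ e^f dμ` — Jensen for `exp` under the tilted
probability measure `μ.tilted f`, using `∫ e^{g−f} d(μ.tilted f) = (∫ e^g dμ)/(∫ e^f dμ)`. [folklore] -/
theorem integral_sub_le_log_integral_exp_sub_log_integral_exp (f g : α → ℝ)
    (hf : Integrable (fun x => Real.exp (f x)) μ) (hg : Integrable (fun x => Real.exp (g x)) μ)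
    (hgf : Integrable (fun x => Real.exp (f x) * (g x - f x)) μ) :
    ∫ x, (g x - f x) ∂μ.tilted f ≤ Real.log (∫ x, Real.exp (g x) ∂μ) - Real.log (∫ x, Real.exp (f x) ∂μ) := by
  haveI := isProbabilityMeasure_tilted (μ := μ) hf
  have hZf : 0 < ∫ x, Real.exp (f x) ∂μ := integral_exp_pos hf
  have hZg : 0 < ∫ x, Real.exp (g x) ∂μ := integral_exp_pos hg
  -- integrability under the tilt
  have hi1 : Integrable (fun x => g x - f x) (μ.tilted f) := by
    rw [integrable_tilted_iff hf]
    simpa only [smul_eq_mul] using hgf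
  have hi2 : Integrable (fun x => Real.exp (g x - f x)) (μ.tilted f) := by
    rw [integrable_tilted_iff hf]
    refine hg.congr (ae_of_all _ fun x => ?_)
    show Real.exp (g x) = Real.exp (f x) • Real.exp (g x - f x)
    rw [smul_eq_mul, ← Real.exp_add]
    congr 1; ring
  -- Jensen under the tilt
  have hJ := ConvexOn.map_integral_le (μ := μ.tilted f) convexOn_exp Real.continuous_exp.continuousOn isClosed_univ
    (ae_of_all _ fun _ => Set.mem_univ _) hi1 hi2
  have hval : ∫ x, Real.exp (g x - f x) ∂μ.tilted f = (∫ x, Real.exp (g x) ∂μ) / ∫ x, Real.exp (f x) ∂μ := by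
    have h := integral_exp_tilted (μ := μ) f (fun x => g x - f x)
    have hfg : (fun x => Real.exp ((f + fun x => g x - f x) x)) = fun x => Real.exp (g x) := by
      funext x; simp
    rw [hfg] at h
    exact h
  have hJ' : Real.exp (∫ x, (g x - f x) ∂μ.tilted f) ≤ (∫ x, Real.exp (g x) ∂μ) / ∫ x, Real.exp (f x) ∂μ :=
    calc Real.exp (∫ x, (g x - f x) ∂μ.tilted f) ≤ ∫ x, Real.exp (g x - f x) ∂μ.tilted f := hJ
      _ = _ := hval
  have hlog := Real.log_le_log (Real.exp_pos _) hJ'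
  rwa [Real.log_exp, Real.log_div hZg.ne' hZf.ne'] at hlog

/-- **The two-sided Gibbs (Peierls–Bogoliubov) sandwich.**  With `Z_f = ∫e^f dμ`, `Z_g = ∫e^g dμ` and the tilted states
`μ_f = μ.tilted f`, `μ_g = μ.tilted g`:  `∫ (g − f) dμ_f ≤ log Z_g − log Z_f ≤ ∫ (g − f) dμ_g`.  (Boltzmann form: `f = −V₀`,
`g = −V₁`, `W = V₁ − V₀`: `−E₀[W] ≤ log(Z₁/Z₀) ≤ −E₁[W]`.) [folklore] -/
theorem gibbs_two_sided (f g : α → ℝ)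
    (hf : Integrable (fun x => Real.exp (f x)) μ) (hg : Integrable (fun x => Real.exp (g x)) μ)
    (hgf : Integrable (fun x => Real.exp (f x) * (g x - f x)) μ)
    (hfg : Integrable (fun x => Real.exp (g x) * (g x - f x)) μ) :
    ∫ x, (g x - f x) ∂μ.tilted f ≤ Real.log (∫ x, Real.exp (g x) ∂μ) - Real.log (∫ x, Real.exp (f x) ∂μ) ∧
      Real.log (∫ x, Real.exp (g x) ∂μ) - Real.log (∫ x, Real.exp (f x) ∂μ) ≤ ∫ x, (g x - f x) ∂μ.tilted g := by
  refine ⟨integral_sub_le_log_integral_exp_sub_log_integral_exp f g hf hg hgf, ?_⟩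
  have hfg' : Integrable (fun x => Real.exp (g x) * (f x - g x)) μ := by
    refine (hfg.neg).congr (ae_of_all _ fun x => ?_)
    simp only [Pi.neg_apply]; ring
  have h := integral_sub_le_log_integral_exp_sub_log_integral_exp g f hg hf hfg'
  have hneg : ∫ x, (f x - g x) ∂μ.tilted g = -∫ x, (g x - f x) ∂μ.tilted g := by
    rw [← integral_neg]
    refine integral_congr_ae (ae_of_all _ fun x => ?_)
    simp only; ring
  rw [hneg] at h
  linarith

/-- One weight, lower side (Jensen): `∫ g dμ ≤ log ∫ e^g dμ`. [folklore] -/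
theorem integral_le_log_integral_exp' (g : α → ℝ) (hg : Integrable (fun x => Real.exp (g x)) μ)
    (hgi : Integrable g μ) :
    ∫ x, g x ∂μ ≤ Real.log (∫ x, Real.exp (g x) ∂μ) := by
  have hgf : Integrable (fun x => Real.exp ((fun _ => (0 : ℝ)) x) * (g x - (fun _ => (0 : ℝ)) x)) μ := by
    simpa using hgi
  have h := integral_sub_le_log_integral_exp_sub_log_integral_exp (μ := μ) (fun _ => (0 : ℝ)) g
    (by simp) hg hgf
  simpa [tilted_zero] using h

/-- One weight, upper side (Gibbs): `log ∫ e^g dμ ≤ (∫ e^g g dμ)/(∫ e^g dμ)` (`= ∫ g d(μ.tilted g)`). [folklore] -/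
theorem log_integral_exp_le_div (g : α → ℝ) (hg : Integrable (fun x => Real.exp (g x)) μ)
    (hgg : Integrable (fun x => Real.exp (g x) * g x) μ) :
    Real.log (∫ x, Real.exp (g x) ∂μ) ≤ (∫ x, Real.exp (g x) * g x ∂μ) / ∫ x, Real.exp (g x) ∂μ := by
  have hgf : Integrable (fun x => Real.exp (g x) * ((fun _ => (0 : ℝ)) x - g x)) μ := by
    refine hgg.neg.congr (ae_of_all _ fun x => ?_)
    simp only [Pi.neg_apply]
    ring
  have h := integral_sub_le_log_integral_exp_sub_log_integral_exp (μ := μ) g (fun _ => (0 : ℝ)) hg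
    (by simp) hgf
  rw [integral_tilted_eq_div] at h
  have hneg : ∫ x, Real.exp (g x) * ((fun _ => (0 : ℝ)) x - g x) ∂μ = -∫ x, Real.exp (g x) * g x ∂μ := by
    rw [← integral_neg]
    refine integral_congr_ae (ae_of_all _ fun x => ?_)
    simp only
    ring
  rw [hneg, neg_div] at h
  have h1 : Real.log (∫ x, Real.exp ((fun _ => (0 : ℝ)) x) ∂μ) = 0 := by simp
  rw [h1] at h
  linarith

end Abstract

/-! ### The torus Wilson state: continuous potentials -/

section Wilson

variable {G : Type} [Group G] [TopologicalSpace G] [IsTopologicalGroup G] [CompactSpace G]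
  [MeasurableSpace G] [BorelSpace G]

/-- **Two-sided Gibbs bounds for the torus Wilson state** (ratio form).  For a lattice representation `r`, `β`, torus side
`L` and CONTINUOUS potentials `V₀, V₁` on the torus configuration space, with `E = wilsonExpectation r.ρ β`,
`Z_i = E[e^{−V_i}]` and `E_i[F] = E[e^{−V_i} F]/Z_i` (the `V_i`-perturbed torus state):
`−E₀[V₁ − V₀] ≤ log Z₁ − log Z₀ ≤ −E₁[V₁ − V₀]`. [folklore] -/
theorem wilson_gibbs_two_sided (r : LatticeRep G) (β : ℝ) {L : ℕ} [NeZero L] {V₀ V₁ : GaugeConfig 4 L G → ℝ}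
    (hV₀ : Continuous V₀) (hV₁ : Continuous V₁) :
    -(wilsonExpectation r.ρ β (fun U => Real.exp (-V₀ U) * (V₁ U - V₀ U)) /
          wilsonExpectation r.ρ β (fun U => Real.exp (-V₀ U))) ≤
        Real.log (wilsonExpectation r.ρ β fun U => Real.exp (-V₁ U)) -
          Real.log (wilsonExpectation r.ρ β fun U => Real.exp (-V₀ U)) ∧
      Real.log (wilsonExpectation r.ρ β fun U => Real.exp (-V₁ U)) -
          Real.log (wilsonExpectation r.ρ β fun U => Real.exp (-V₀ U)) ≤
        -(wilsonExpectation r.ρ β (fun U => Real.exp (-V₁ U) * (V₁ U - V₀ U)) /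
          wilsonExpectation r.ρ β (fun U => Real.exp (-V₁ U))) := by
  haveI := isProbabilityMeasure_wilsonMeasure (d := 4) (L := L) (G := G) r.ρ r.continuous β
  haveI := r.secondCountableTopology
  -- integrability is free on the compact torus configuration space (cf. the `JensenFloor` toolkit's `integrable_of_continuous`)
  have integrable_wilsonMeasure_of_continuous : ∀ (r' : LatticeRep G) (β' : ℝ) {f : GaugeConfig 4 L G → ℝ}, Continuous f →
      Integrable f (wilsonMeasure (d := 4) (L := L) r.ρ β) := fun _ _ f hf =>
    hf.integrable_of_hasCompactSupport (HasCompactSupport.of_compactSpace _)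
  have hf : Integrable (fun U => Real.exp (-V₀ U)) (wilsonMeasure (d := 4) (L := L) r.ρ β) :=
    integrable_wilsonMeasure_of_continuous r β (Real.continuous_exp.comp hV₀.neg)
  have hg : Integrable (fun U => Real.exp (-V₁ U)) (wilsonMeasure (d := 4) (L := L) r.ρ β) :=
    integrable_wilsonMeasure_of_continuous r β (Real.continuous_exp.comp hV₁.neg)
  have hgf : Integrable (fun U => Real.exp (-V₀ U) * (-V₁ U - -V₀ U)) (wilsonMeasure (d := 4) (L := L) r.ρ β) :=
    integrable_wilsonMeasure_of_continuous r β ((Real.continuous_exp.comp hV₀.neg).mul (hV₁.neg.sub hV₀.neg))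
  have hfg : Integrable (fun U => Real.exp (-V₁ U) * (-V₁ U - -V₀ U)) (wilsonMeasure (d := 4) (L := L) r.ρ β) :=
    integrable_wilsonMeasure_of_continuous r β ((Real.continuous_exp.comp hV₁.neg).mul (hV₁.neg.sub hV₀.neg))
  have h := gibbs_two_sided (μ := wilsonMeasure (d := 4) (L := L) r.ρ β) (fun U => -V₀ U) (fun U => -V₁ U) hf hg hgf hfg
  rw [integral_tilted_eq_div, integral_tilted_eq_div] at h
  have e0 : ∫ U, Real.exp (-V₀ U) * (-V₁ U - -V₀ U) ∂wilsonMeasure (d := 4) (L := L) r.ρ β =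
      -∫ U, Real.exp (-V₀ U) * (V₁ U - V₀ U) ∂wilsonMeasure (d := 4) (L := L) r.ρ β := by
    rw [← integral_neg]
    refine integral_congr_ae (ae_of_all _ fun U => ?_)
    simp only; ring
  have e1 : ∫ U, Real.exp (-V₁ U) * (-V₁ U - -V₀ U) ∂wilsonMeasure (d := 4) (L := L) r.ρ β =
      -∫ U, Real.exp (-V₁ U) * (V₁ U - V₀ U) ∂wilsonMeasure (d := 4) (L := L) r.ρ β := by
    rw [← integral_neg]
    refine integral_congr_ae (ae_of_all _ fun U => ?_)
    simp only; ring
  rw [e0, e1, neg_div, neg_div] at h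
  unfold wilsonExpectation
  exact h

/-- **Upper Gibbs bound for a sourced torus partition function**: for a continuous `W`,
`log E[e^{−W}] ≤ −E[e^{−W} W]/E[e^{−W}]` — minus the mean of `W` in the `W`-perturbed torus state (the upper companion of
the Jensen floor `wilsonExpectation_le_log_wilsonExpectation_exp`: `−E[W] ≤ log E[e^{−W}]`). [folklore] -/
theorem log_wilsonExpectation_exp_neg_le (r : LatticeRep G) (β : ℝ) {L : ℕ} [NeZero L] {W : GaugeConfig 4 L G → ℝ}
    (hW : Continuous W) :
    Real.log (wilsonExpectation r.ρ β fun U => Real.exp (-W U)) ≤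
      -(wilsonExpectation r.ρ β (fun U => Real.exp (-W U) * W U) / wilsonExpectation r.ρ β (fun U => Real.exp (-W U))) := by
  haveI := isProbabilityMeasure_wilsonMeasure (d := 4) (L := L) (G := G) r.ρ r.continuous β
  haveI := r.secondCountableTopology
  have integrable_wilsonMeasure_of_continuous : ∀ (r' : LatticeRep G) (β' : ℝ) {f : GaugeConfig 4 L G → ℝ}, Continuous f →
      Integrable f (wilsonMeasure (d := 4) (L := L) r.ρ β) := fun _ _ f hf =>
    hf.integrable_of_hasCompactSupport (HasCompactSupport.of_compactSpace _)
  have hg : Integrable (fun U => Real.exp (-W U)) (wilsonMeasure (d := 4) (L := L) r.ρ β) :=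
    integrable_wilsonMeasure_of_continuous r β (Real.continuous_exp.comp hW.neg)
  have hgg : Integrable (fun U => Real.exp (-W U) * -W U) (wilsonMeasure (d := 4) (L := L) r.ρ β) :=
    integrable_wilsonMeasure_of_continuous r β ((Real.continuous_exp.comp hW.neg).mul hW.neg)
  have h := log_integral_exp_le_div (μ := wilsonMeasure (d := 4) (L := L) r.ρ β) (fun U => -W U) hg hgg
  have e : ∫ U, Real.exp (-W U) * -W U ∂wilsonMeasure (d := 4) (L := L) r.ρ β =
      -∫ U, Real.exp (-W U) * W U ∂wilsonMeasure (d := 4) (L := L) r.ρ β := by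
    rw [← integral_neg]
    refine integral_congr_ae (ae_of_all _ fun U => ?_)
    simp only; ring
  rw [e, neg_div] at h
  unfold wilsonExpectation
  exact h

end Wilson

end Summit.QuantumFields.YangMills.Theorems.SourcedPressureJensen

end
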